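import Summits.HubbardSuperconductivity.HubbardSuperconductivity.Theses.DeformationLadder
import Summits.HubbardSuperconductivity.HubbardSuperconductivity.Theorems.DeformationLadderEnergySandwich
import Summits.HubbardSuperconductivity.HubbardSuperconductivity.Theorems.ThermalWedgeTwSeededEnsembleEquivalenceT0AHM
import Summits.HubbardSuperconductivity.HubbardSuperconductivity.Theorems.ThermalWedgeTwPureThermalBoundGseeMaster
import Summits.HubbardSuperconductivity.HubbardSuperconductivity.Theorems.TwSeededEnsembleEquivalence.Negative.ObstructionTemplates
import Literature.MathematicalPhysics.QuantumLattice.HubbardTorus2DEnergyDensityConvex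
import Literature.MathematicalPhysics.QuantumLattice.FreeFermiGasNoDWaveOrder
import Literature.MathematicalPhysics.QuantumLattice.HubbardRingPerronFrobeniusProofs
import Literature.MathematicalPhysics.QuantumLattice.HubbardModelParticleHoleProofs
import Literature.MathematicalPhysics.QuantumLattice.FinDimSpectrumProofs
import Literature.MathematicalPhysics.QuantumLattice.DWaveSourceProofs
import HarnessLib

/-!
# `LowEnergyRigidity` (stmt-HubbardSuperconductivity-1892) — the weak-coupling ORDER CEILING (core)

Tightness for the corner crux `LowEnergyRigidity` of route `DeformationLadder` and its class
(`LadderThesis` stmt-1890, `TwistGap.TgThesis` stmt-1508, the summit's every-ground-state form; the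
by-name corollaries are in `…OrderCeilingWitnesses.lean`): **a d-wave LRO density `a` carried, at
every large even side, by SOME unit vector of the `(2⌊(1-δ)L²/2⌋, S^z=0)` sector of the pure torus
`H_L(U) = hubbardTorus 2 L 1 U` within a fixed energy `κ` of the sector ground energy satisfies
`a ≤ 64√2·√U`** (`order_le_sqrt_coupling`; at `U = 0`, `a ≤ 0`). The order the corner can assert is
`O(√U)`: not uniform in the coupling (expected truth `e^{-c/U²}`,
`Literature.Barriers.HubbardSuperconductivity.WeakCouplingCeiling`).

Mechanism (the route's rung read backwards; no expansion in `U`). For `g > 0` and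
`K = H_L(U) − μN − (g/L²)Δ_dᴴΔ_d`:
`(g/L²)Re⟨φ, Δ_dᴴΔ_d φ⟩ = Re⟨φ, H_L(U)φ⟩ − μN_L − Re⟨φ, Kφ⟩ ≤ [E_L(N_L) + κ − μN_L] − E₀(K)`, and
* GSEE (`gsee_line`, from the master bounds of `ThermalWedgeTwPureThermalBoundGseeMaster`, ALL
  `U ≥ 0`, all densities in `(0,2)`): `E_L(N_L) − μN_L ≤ E₀(H_L(U) − μN) + ηL²` eventually;
* `stub_t0AHM` (hard half of the finite-volume `T = 0` approximating-Hamiltonian bound):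
  `E₀(K) ≥ E₀(dWaveSourceTorus L U μ h) + h²L²/g − εL²` for some `h ≥ 0`, eventually;
* the repulsion sandwich `energySandwich_proof` (stmt-1899) and the FREE sourced gain bound
  `groundEnergy_gain_dWaveSourceTorus_zero_le` at shell width `η = h²/(128g²)` (`free_deformed_lb`:
  the free gas pays back at most `2048 g²L² + 64 g` beyond `h²L²/g`).
Hence, eventually in `L` and uniformly over the window, `g·LRO(φ) ≤ U + 2048 g² + ε` for every
`g > 0` (`window_coupling_mul_lro_le`), `LRO(φ) ≤ 64√2·√U + ε` (`window_lro_le`, `g = √U/(32√2)`;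
`groundStates_lro_le` for sector ground states), and `a ≤ 64√2·√U` for witnesses
(`order_le_sqrt_coupling`).
Bogolyubov Jr. (1966); Bru–de Siqueira Pedra, Mem. AMS 224 (2013) Thm 107; Ruelle (1969) §3.4;
Bardeen–Cooper–Schrieffer (1957) (free BdG levels). Nothing here refutes an item.
-/

noncomputable section

set_option linter.dupNamespace false

namespace Summit.HubbardSuperconductivity.HubbardSuperconductivity.Theorems.LowEnergyRigidity.OrderCeiling

open Matrix Filter Finset
open Literature.MathematicalPhysics.QuantumLattice Literature.Probability.LatticeModels
open Literature.MathematicalPhysics.QuantumLattice.ThermodynamicLimit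
open Summit.HubbardSuperconductivity.HubbardSuperconductivity.Theorems
open Summit.HubbardSuperconductivity.HubbardSuperconductivity.Theorems.TwPureThermalBoundGsee
open Summit.HubbardSuperconductivity.HubbardSuperconductivity.Theorems.TwSeededEnsembleEquivalence.ExposedDensity
open Summit.HubbardSuperconductivity.HubbardSuperconductivity.Theorems.TwSeededEnsembleEquivalence.Negative
  (isHermitian_seededGC)
open scoped ComplexOrder

/-! ### GSEE for every coupling and density: the canonical sector energy sits on the grand-canonical line -/

/-- **Ground-state equivalence of ensembles, general form.** For every `U ≥ 0` and every density
`n₀ ∈ (0,2)` there is a chemical potential `μ` (a subgradient at `n₀` of the convex limiting energy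
density `energyDensity2D 1 U`) such that the canonical torus energy at `N_L(n₀) = 2⌊n₀L²/2⌋`
particles satisfies `E_L(N_L) − μN_L ≤ E₀(H_L(U) − μN) + ηL²` eventually in `L`, for every `η > 0`
(master bounds of the `ThermalWedge` GSEE development; no window and no smallness of `U`).
[cite: Ruelle1969, §3.4] -/
theorem gsee_line {U : ℝ} (hU : 0 ≤ U) {n₀ : ℝ} (hn0 : 0 < n₀) (hn2 : n₀ < 2) :
    ∃ μ : ℝ, ∀ η : ℝ, 0 < η → ∃ L₀ : ℕ, ∀ L : ℕ, L₀ ≤ L →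
      groundEnergyAt (fermionTorusGraph 2 L) 1 U (rectN n₀ L) - μ * (rectN n₀ L : ℝ) ≤
        (hubbardTorusWith 2 L 1 U μ).groundEnergy + η * (L : ℝ) ^ 2 := by
  obtain ⟨s, hs⟩ := exists_subgradient_of_convexOn_Ico (convexOn_energyDensity2D 1 hU) ⟨hn0, hn2⟩
  refine ⟨s, fun η hη => ?_⟩
  have hη3 : 0 < η / 3 := by positivity
  obtain ⟨L₁, hL₁⟩ := master_lb hU hs hη3
  obtain ⟨L₂, hL₂⟩ := master_ub hU hn0.le hn2 hη3
  obtain ⟨L₃, hL₃⟩ := exists_nat_gt (6 * |s| / η)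
  refine ⟨max (max L₁ L₂) (max L₃ 1), fun L hL => ?_⟩
  have hLL₁ : L₁ ≤ L := (le_max_left _ _).trans ((le_max_left _ _).trans hL)
  have hLL₂ : L₂ ≤ L := (le_max_right _ _).trans ((le_max_left _ _).trans hL)
  have hLL₃ : L₃ ≤ L := (le_max_left _ _).trans ((le_max_right _ _).trans hL)
  have hL1 : 1 ≤ L := (le_max_right _ _).trans ((le_max_right _ _).trans hL)
  have hL1r : (1 : ℝ) ≤ L := by exact_mod_cast hL1
  obtain ⟨N, hN, hgc⟩ := exists_gcSector L U s
  have h1 := hL₁ L hLL₁ N hN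
  have h2 := hL₂ L hLL₂
  have h3 := rectN_le hn0.le L
  have h4 := lt_rectN_add_two n₀ L
  have hslack : 2 * |s| ≤ η / 3 * (L : ℝ) ^ 2 := by
    have : 6 * |s| / η < L := hL₃.trans_le (by exact_mod_cast hLL₃)
    rw [div_lt_iff₀ hη] at this
    nlinarith [abs_nonneg s]
  have h5 : s * (n₀ * (L : ℝ) ^ 2 - rectN n₀ L) ≤ 2 * |s| := by
    calc s * (n₀ * (L : ℝ) ^ 2 - rectN n₀ L) ≤ |s * (n₀ * (L : ℝ) ^ 2 - rectN n₀ L)| := le_abs_self _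
      _ = |s| * |n₀ * (L : ℝ) ^ 2 - rectN n₀ L| := abs_mul _ _
      _ ≤ |s| * 2 := mul_le_mul_of_nonneg_left (abs_le.2 ⟨by linarith, by linarith⟩) (abs_nonneg s)
      _ = 2 * |s| := by ring
  rw [hgc]
  nlinarith [h1, h2, h5, hslack]

/-! ### The free gas pays back at most `O(g²)L²`: a finite-volume lower bound for the sourced free energy -/

/-- **Free sourced lower bound.** For `L ≥ 3`, `g > 0`, every `μ` and every source `h`:
`E₀(dWaveSourceTorus L 0 μ 0) − 2048 g² L² − 64 g ≤ E₀(dWaveSourceTorus L 0 μ h) + h²L²/g` —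
the free sourced gain bound `groundEnergy_gain_dWaveSourceTorus_zero_le` at shell width
`η = h²/(128 g²)` gives `E₀(0) − E₀(h) ≤ h²L²/(2g) + 8√2|h|L + 2048 g²L²`, and
`h²L²/(2g) − 8√2|h|L ≥ −64g`. [folklore] -/
theorem free_deformed_lb (L : ℕ) [NeZero L] (hL : 3 ≤ L) (μ h : ℝ) {g : ℝ} (hg : 0 < g) :
    (dWaveSourceTorus L 0 μ 0).groundEnergy - 2048 * g ^ 2 * (L : ℝ) ^ 2 - 64 * g ≤
      (dWaveSourceTorus L 0 μ h).groundEnergy + h ^ 2 * (L : ℝ) ^ 2 / g := by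
  have hL0 : (0 : ℝ) < L := by exact_mod_cast Nat.pos_of_ne_zero (NeZero.ne L)
  rcases eq_or_ne h 0 with rfl | hh
  · have : 0 ≤ 2048 * g ^ 2 * (L : ℝ) ^ 2 := by positivity
    simp only [ne_eq, OfNat.ofNat_ne_zero, not_false_eq_true, zero_pow, zero_mul, zero_div,
      add_zero]
    linarith
  set r : ℝ := Real.sqrt 2 with hr
  have hr0 : 0 < r := Real.sqrt_pos.2 (by norm_num)
  have hr2 : r ^ 2 = 2 := Real.sq_sqrt (by norm_num)
  set A : ℝ := |h| with hA
  have hA0 : 0 < A := abs_pos.2 hh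
  have hA2 : A ^ 2 = h ^ 2 := sq_abs h
  set η : ℝ := (A / (8 * r * g)) ^ 2 with hη
  have hη0 : 0 < η := by positivity
  have hgain := groundEnergy_gain_dWaveSourceTorus_zero_le hL μ h hη0
  have hsqrt : Real.sqrt η = A / (8 * r * g) := Real.sqrt_sq (by positivity)
  -- the two terms of the gain bound at this shell width
  have e1 : 4 * r * A * (Real.sqrt η * (L : ℝ) ^ 2 + 2 * L) =
      h ^ 2 * (L : ℝ) ^ 2 / (2 * g) + 8 * r * A * L := by
    rw [hsqrt, ← hA2]
    field_simp
    ring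
  have e2 : (4 * r * A) ^ 2 / (2 * η) * (L : ℝ) ^ 2 = 2048 * g ^ 2 * (L : ℝ) ^ 2 := by
    have h32 : (4 * r * A) ^ 2 = 32 * A ^ 2 := by rw [mul_pow, mul_pow, hr2]; ring
    have hη' : η = A ^ 2 / (128 * g ^ 2) := by
      rw [hη, div_pow, mul_pow, mul_pow, hr2]; ring
    rw [h32, hη']
    field_simp
    ring
  rw [e1, e2] at hgain
  -- complete the square: `h²L²/(2g) − 8√2|h|L ≥ −64g`
  have hsq : -(64 * g) ≤ h ^ 2 * (L : ℝ) ^ 2 / (2 * g) - 8 * r * A * L := by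
    have key : 0 ≤ (A * L - 8 * r * g) ^ 2 := sq_nonneg _
    have hexp : (A * L - 8 * r * g) ^ 2 = h ^ 2 * (L : ℝ) ^ 2 - 16 * r * g * (A * L) + 128 * g ^ 2 := by
      rw [sub_sq, mul_pow, hA2, mul_pow, mul_pow, hr2]; ring
    rw [hexp] at key
    have h2g : (0 : ℝ) < 2 * g := by positivity
    rw [le_sub_iff_add_le, le_div_iff₀ h2g]
    nlinarith [key]
  have hid : h ^ 2 * (L : ℝ) ^ 2 / g = 2 * (h ^ 2 * (L : ℝ) ^ 2 / (2 * g)) := by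
    field_simp
  linarith


/-! ### The deformed grand-canonical matrix `K = H_L(U) − μN − (g/L²)Δ_dᴴΔ_d` -/

/-- On a unit `N`-particle vector, `Re⟨φ, Kφ⟩ = Re⟨φ, H_L(U)φ⟩ − μN − (g/L²) Re⟨φ, Δ_dᴴΔ_d φ⟩`.
[folklore] -/
theorem re_rayleigh_deformedGC (L : ℕ) [NeZero L] (U μ g : ℝ) {N : ℕ}
    {φ : Fock (Orb (FermionTorus 2 L))} (hN : IsNParticle N φ) (hφ : star φ ⬝ᵥ φ = 1) :
    (star φ ⬝ᵥ ((hubbardTorusWith 2 L 1 U μ - ((g / (L : ℝ) ^ 2 : ℝ) : ℂ) •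
      ((pairField dWaveFormFactor L)ᴴ * pairField dWaveFormFactor L)) *ᵥ φ)).re =
      (star φ ⬝ᵥ (hubbardTorus 2 L 1 U *ᵥ φ)).re - μ * N -
        g / (L : ℝ) ^ 2 *
          (star φ ⬝ᵥ (((pairField dWaveFormFactor L)ᴴ * pairField dWaveFormFactor L) *ᵥ φ)).re := by
  rw [hubbardTorusWith_eq, sub_mulVec, sub_mulVec, smul_mulVec, smul_mulVec,
    totalNumber_mulVec_of_isNParticle hN, smul_smul, dotProduct_sub, dotProduct_sub,
    dotProduct_smul, dotProduct_smul, hφ, Complex.sub_re, Complex.sub_re]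
  simp only [smul_eq_mul, mul_one, Complex.mul_re, Complex.ofReal_re,
    Complex.ofReal_im, Complex.natCast_re, Complex.natCast_im, mul_zero, sub_zero, zero_mul]

/-! ### The uniform window bound `g·LRO ≤ U + 2048 g² + ε` and the ceiling `LRO ≤ 64√2 √U + ε` -/

/-- **The coupling–order inequality, uniformly over the energy window.** Let `U ≥ 0`,
`0 < 1 − δ < 2`, `κ ∈ ℝ`, `g > 0`, `ε > 0`. Then for all large sides `L` (any parity) and EVERY unit
vector `φ` of the `(2⌊(1−δ)L²/2⌋, S^z=0)` sector of `H_L(U)` within `κ` of the sector ground energy,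
`g · L⁻⁴Re⟨φ, Δ_dᴴΔ_d φ⟩ ≤ U + 2048 g² + ε`: GSEE puts the sector energy on the grand-canonical line,
the `T = 0` approximating-Hamiltonian bound and the repulsion sandwich reduce the deformed
grand-canonical energy to FREE sourced energies, and the free gas pays back at most `2048 g²L² + 64 g`
(`free_deformed_lb`). The threshold in `L` depends on `(U, δ, κ, g, ε)` only, not on `φ`.
[cite: BruPedra2013, Thm 107] -/
theorem window_coupling_mul_lro_le {U δ : ℝ} (hU : 0 ≤ U) (hδ0 : 0 < 1 - δ) (hδ2 : 1 - δ < 2)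
    (κ : ℝ) {g : ℝ} (hg : 0 < g) {ε : ℝ} (hε : 0 < ε) :
    ∃ L₀ : ℕ, ∀ (L : ℕ) [NeZero L], L₀ ≤ L → ∀ φ : Fock (Orb (FermionTorus 2 L)),
      φ ∈ szSector (2 * ⌊(1 - δ) * (L : ℝ) ^ 2 / 2⌋₊) 0 → star φ ⬝ᵥ φ = 1 →
      (star φ ⬝ᵥ (hubbardTorus 2 L 1 U *ᵥ φ)).re ≤
        (hubbardTorus 2 L 1 U).minEnergyOn (szSector (2 * ⌊(1 - δ) * (L : ℝ) ^ 2 / 2⌋₊) 0) + κ →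
      g * ((expect ((pairField dWaveFormFactor L)ᴴ * pairField dWaveFormFactor L) φ).re /
        (L : ℝ) ^ 4) ≤ U + 2048 * g ^ 2 + ε := by
  obtain ⟨μ, hμ⟩ := gsee_line hU hδ0 hδ2
  obtain ⟨-, hhard⟩ := stub_t0AHM U g |μ| hg
  have hsand := energySandwich_proof
  unfold Summit.HubbardSuperconductivity.HubbardSuperconductivity.Theses.DeformationLadder.EnergySandwich
    at hsand
  have hε3 : 0 < ε / 3 := by positivity
  obtain ⟨L₁, hL₁⟩ := hμ (ε / 3) hε3
  obtain ⟨L₂, hL₂⟩ := hhard (ε / 3) hε3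
  obtain ⟨L₃, hL₃⟩ := exists_nat_gt ((|κ| + 64 * g) / (ε / 3))
  refine ⟨max (max L₁ L₂) (max L₃ 3), fun L _ hL φ hφK hφ1 hφE => ?_⟩
  have hLL₁ : L₁ ≤ L := (le_max_left _ _).trans ((le_max_left _ _).trans hL)
  have hLL₂ : L₂ ≤ L := (le_max_right _ _).trans ((le_max_left _ _).trans hL)
  have hLL₃ : L₃ ≤ L := (le_max_left _ _).trans ((le_max_right _ _).trans hL)
  have hL3 : 3 ≤ L := (le_max_right _ _).trans ((le_max_right _ _).trans hL)
  have hL0 : (0 : ℝ) < L := by exact_mod_cast (show 0 < L by omega)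
  have hL2 : (0 : ℝ) < (L : ℝ) ^ 2 := by positivity
  have hL4 : (0 : ℝ) < (L : ℝ) ^ 4 := by positivity
  obtain ⟨hφN, -⟩ := (mem_szSector_iff _ _ φ).1 hφK
  -- the sector energy is the `N_L`-particle energy (`SU(2)`), `N_L = rectN (1 − δ) L`
  have hNL : 2 * ⌊(1 - δ) * (L : ℝ) ^ 2 / 2⌋₊ = rectN (1 - δ) L := rfl
  have hhalf : ⌊(1 - δ) * (L : ℝ) ^ 2 / 2⌋₊ ≤ Fintype.card (FermionTorus 2 L) := by
    have h := rectN_le_two_mul hδ0.le hδ2.le L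
    rw [card_fermionTorus_two']
    rw [← hNL] at h
    omega
  have hSU2 := groundEnergyAt_eq_minEnergyOn_szSector (fermionTorusGraph 2 L) 1 U hhalf
  have hE : (star φ ⬝ᵥ (hubbardTorus 2 L 1 U *ᵥ φ)).re ≤
      groundEnergyAt (fermionTorusGraph 2 L) 1 U (rectN (1 - δ) L) + κ := by
    rw [← hNL, hSU2]; exact hφE
  -- GSEE, approximating Hamiltonian (hard half), sandwich, free lower bound, at this `L`
  have hG := hL₁ L hLL₁
  rw [← dWaveSourceTorus_zero L U μ] at hG
  obtain ⟨hh, -, hAH⟩ := hL₂ L hLL₂ μ le_rfl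
  have hs1 := (hsand L U μ hh hU).1
  have hs2 := (hsand L U μ 0 hU).2
  have hfree := free_deformed_lb L hL3 μ hh hg
  -- the variational principle for `K` in the state `φ`
  have hray := Matrix.groundEnergy_le_rayleigh_holds (isHermitian_seededGC L U μ g) φ hφ1
  rw [re_rayleigh_deformedGC L U μ g hφN hφ1, hNL] at hray
  -- the `O(1)` slack
  have hthr : |κ| + 64 * g ≤ ε / 3 * (L : ℝ) ^ 2 := by
    have h1 : (|κ| + 64 * g) / (ε / 3) < L := hL₃.trans_le (by exact_mod_cast hLL₃)
    rw [div_lt_iff₀ hε3] at h1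
    have hL1 : (1 : ℝ) ≤ L := by exact_mod_cast (show 1 ≤ L by omega)
    nlinarith [abs_nonneg κ]
  have hκ := le_abs_self κ
  -- assemble
  set P : ℝ := (star φ ⬝ᵥ (((pairField dWaveFormFactor L)ᴴ * pairField dWaveFormFactor L) *ᵥ φ)).re
    with hP
  have key : g * (P / (L : ℝ) ^ 4) * (L : ℝ) ^ 2 ≤ (U + 2048 * g ^ 2 + ε) * (L : ℝ) ^ 2 := by
    have e : g * (P / (L : ℝ) ^ 4) * (L : ℝ) ^ 2 = g / (L : ℝ) ^ 2 * P := by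
      field_simp
    rw [e]
    nlinarith [hray, hE, hG, hAH, hs1, hs2, hfree, hthr, hκ]
  have := le_of_mul_le_mul_right key hL2
  simpa [Literature.MathematicalPhysics.QuantumLattice.expect, hP] using this

/-- **The weak-coupling order ceiling, uniformly over the energy window.** For `U ≥ 0`,
`0 < 1 − δ < 2`, `κ ∈ ℝ` and `ε > 0`: for all large sides `L` and EVERY unit vector `φ` of the
`(2⌊(1−δ)L²/2⌋, S^z=0)` sector of `H_L(U)` within `κ` of the sector ground energy,
`L⁻⁴Re⟨φ, Δ_dᴴΔ_d φ⟩ ≤ 64√2·√U + ε` (`g = √U/(32√2)` in `window_coupling_mul_lro_le`; at `U = 0`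
the bound is `ε`). In words: the d-wave LRO density of every low-energy state of the pure 2D
Hubbard torus — in particular of every sector ground state — is `O(√U)` asymptotically in the
side. [cite: BruPedra2013, Thm 107] -/
theorem window_lro_le {U δ : ℝ} (hU : 0 ≤ U) (hδ0 : 0 < 1 - δ) (hδ2 : 1 - δ < 2) (κ : ℝ)
    {ε : ℝ} (hε : 0 < ε) :
    ∃ L₀ : ℕ, ∀ (L : ℕ) [NeZero L], L₀ ≤ L → ∀ φ : Fock (Orb (FermionTorus 2 L)),
      φ ∈ szSector (2 * ⌊(1 - δ) * (L : ℝ) ^ 2 / 2⌋₊) 0 → star φ ⬝ᵥ φ = 1 →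
      (star φ ⬝ᵥ (hubbardTorus 2 L 1 U *ᵥ φ)).re ≤
        (hubbardTorus 2 L 1 U).minEnergyOn (szSector (2 * ⌊(1 - δ) * (L : ℝ) ^ 2 / 2⌋₊) 0) + κ →
      (expect ((pairField dWaveFormFactor L)ᴴ * pairField dWaveFormFactor L) φ).re / (L : ℝ) ^ 4 ≤
        64 * Real.sqrt 2 * Real.sqrt U + ε := by
  rcases hU.eq_or_lt with hU0 | hUpos
  · -- `U = 0`: `g = ε/4096`
    have hg : 0 < ε / 4096 := by positivity
    obtain ⟨L₀, h⟩ := window_coupling_mul_lro_le hU hδ0 hδ2 κ hg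
      (ε := ε * (ε / 4096) / 2) (by positivity)
    refine ⟨L₀, fun L _ hL φ hφK hφ1 hφE => ?_⟩
    have h1 := h L hL φ hφK hφ1 hφE
    rw [← hU0, zero_add] at h1
    rw [← hU0, Real.sqrt_zero, mul_zero, zero_add]
    have h2 : ε / 4096 * ((expect ((pairField dWaveFormFactor L)ᴴ * pairField dWaveFormFactor L) φ).re /
        (L : ℝ) ^ 4) ≤ ε / 4096 * ε := by nlinarith [h1]
    exact le_of_mul_le_mul_left h2 hg
  · -- `U > 0`: `g = √U/(32√2)`
    set t : ℝ := Real.sqrt U with ht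
    have ht0 : 0 < t := Real.sqrt_pos.2 hUpos
    have ht2 : t ^ 2 = U := Real.sq_sqrt hU
    set r : ℝ := Real.sqrt 2 with hr
    have hr0 : 0 < r := Real.sqrt_pos.2 (by norm_num)
    have hr2 : r ^ 2 = 2 := Real.sq_sqrt (by norm_num)
    have hg : 0 < t / (32 * r) := by positivity
    obtain ⟨L₀, h⟩ := window_coupling_mul_lro_le hU hδ0 hδ2 κ hg (ε := ε * (t / (32 * r)))
      (by positivity)
    refine ⟨L₀, fun L _ hL φ hφK hφ1 hφE => ?_⟩
    have h1 := h L hL φ hφK hφ1 hφE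
    have hsq : 2048 * (t / (32 * r)) ^ 2 = U := by
      rw [div_pow, mul_pow, hr2, ht2]; ring
    rw [hsq] at h1
    have h2 : t / (32 * r) * ((expect ((pairField dWaveFormFactor L)ᴴ * pairField dWaveFormFactor L)
        φ).re / (L : ℝ) ^ 4) ≤ t / (32 * r) * (64 * r * t + ε) := by
      have e : t / (32 * r) * (64 * r * t + ε) = 2 * t ^ 2 + ε * (t / (32 * r)) := by
        field_simp
        ring
      rw [e, ht2]
      linarith
    exact le_of_mul_le_mul_left h2 hg

/-- **Uniform ceiling for sector ground states.** For `U ≥ 0`, `δ ∈ (−1, 1)` and `ε > 0`: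
eventually in `L`, EVERY normalised `(2⌊(1−δ)L²/2⌋, S^z=0)`-sector ground state `ψ` of the pure
torus `hubbardTorus 2 L 1 U` has d-wave LRO density `L⁻⁴Re⟨ψ, Δ_dᴴΔ_d ψ⟩ ≤ 64√2·√U + ε` — the
order parameter the summit `HubbardSuperconductivity` asks for is `O(√U)`. [cite: BruPedra2013, Thm 107] -/
theorem groundStates_lro_le {U δ : ℝ} (hU : 0 ≤ U) (hδ0 : 0 < 1 - δ) (hδ2 : 1 - δ < 2) {ε : ℝ}
    (hε : 0 < ε) :
    ∃ L₀ : ℕ, ∀ (L : ℕ) [NeZero L], L₀ ≤ L → ∀ ψ : Fock (Orb (FermionTorus 2 L)),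
      star ψ ⬝ᵥ ψ = 1 →
      IsGroundStateInSector (hubbardTorus 2 L 1 U) (2 * ⌊(1 - δ) * (L : ℝ) ^ 2 / 2⌋₊) 0 ψ →
      (expect ((pairField dWaveFormFactor L)ᴴ * pairField dWaveFormFactor L) ψ).re / (L : ℝ) ^ 4 ≤
        64 * Real.sqrt 2 * Real.sqrt U + ε := by
  obtain ⟨L₀, h⟩ := window_lro_le hU hδ0 hδ2 0 hε
  refine ⟨L₀, fun L _ hL ψ hψ1 hψ => ?_⟩
  obtain ⟨hψK, -, hψeig⟩ := hψ
  have hE : (star ψ ⬝ᵥ (hubbardTorus 2 L 1 U *ᵥ ψ)).re =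
      (hubbardTorus 2 L 1 U).minEnergyOn (szSector (2 * ⌊(1 - δ) * (L : ℝ) ^ 2 / 2⌋₊) 0) := by
    rw [hψeig, dotProduct_smul, hψ1, smul_eq_mul, mul_one, Complex.ofReal_re]
  exact h L hL ψ hψK hψ1 (by rw [hE]; linarith)

/-- **The weak-coupling order ceiling for witnesses.** If `U ≥ 0`, `0 < 1 − δ < 2` and for all large
EVEN `L` some unit vector of the `(2⌊(1−δ)L²/2⌋, S^z=0)` sector of `H_L(U)` lies within `κ` of the
sector ground energy and has d-wave LRO density `≥ a`, then `a ≤ 64√2·√U` (at `U = 0`, `a ≤ 0`): the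
order asserted by `LowEnergyRigidity` / `LadderThesis` / `TgThesis` / the summit cannot be uniform in
the coupling. [cite: BruPedra2013, Thm 107] -/
theorem order_le_sqrt_coupling {U δ κ a : ℝ} (hU : 0 ≤ U) (hδ0 : 0 < 1 - δ) (hδ2 : 1 - δ < 2)
    (h : ∃ L₀ : ℕ, ∀ (L : ℕ) [NeZero L], L₀ ≤ L → Even L →
      ∃ φ : Fock (Orb (FermionTorus 2 L)),
        φ ∈ szSector (2 * ⌊(1 - δ) * (L : ℝ) ^ 2 / 2⌋₊) 0 ∧ star φ ⬝ᵥ φ = 1 ∧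
        (star φ ⬝ᵥ (hubbardTorus 2 L 1 U *ᵥ φ)).re ≤
          (hubbardTorus 2 L 1 U).minEnergyOn (szSector (2 * ⌊(1 - δ) * (L : ℝ) ^ 2 / 2⌋₊) 0) + κ ∧
        a ≤ (expect ((pairField dWaveFormFactor L)ᴴ * pairField dWaveFormFactor L) φ).re /
          (L : ℝ) ^ 4) :
    a ≤ 64 * Real.sqrt 2 * Real.sqrt U := by
  obtain ⟨L₀, hL₀⟩ := h
  refine le_of_forall_pos_le_add fun ε hε => ?_
  obtain ⟨L₁, hL₁⟩ := window_lro_le hU hδ0 hδ2 κ hε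
  set L : ℕ := 2 * max (max L₀ L₁) 1 with hLdef
  have hm : max (max L₀ L₁) 1 ≤ L := Nat.le_mul_of_pos_left _ two_pos
  haveI : NeZero L := ⟨by omega⟩
  obtain ⟨φ, hφK, hφ1, hφE, hφa⟩ :=
    hL₀ L ((le_max_left _ _).trans ((le_max_left _ _).trans hm)) (even_two_mul _)
  exact hφa.trans (hL₁ L ((le_max_right _ _).trans ((le_max_left _ _).trans hm)) φ hφK hφ1 hφE)

/-- **The weak-coupling order ceiling — registered closed form** (stub
`lowEnergyRigidity_window_order_ceiling` of stmt-HubbardSuperconductivity-1892; = `window_lro_le` with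
all parameters bound): for `U ≥ 0`, `0 < 1 − δ < 2`, any `κ` and `ε > 0`, eventually in `L` every unit
vector of the `(2⌊(1−δ)L²/2⌋, S^z=0)` sector within `κ` of the sector ground energy has d-wave LRO
density `≤ 64√2·√U + ε`. [cite: BruPedra2013, Thm 107] -/
theorem lowEnergyRigidity_window_order_ceiling :
    ∀ (U δ : ℝ), 0 ≤ U → 0 < 1 - δ → 1 - δ < 2 → ∀ (κ ε : ℝ), 0 < ε →
      ∃ L₀ : ℕ, ∀ (L : ℕ) [NeZero L], L₀ ≤ L → ∀ φ : Fock (Orb (FermionTorus 2 L)),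
        φ ∈ szSector (2 * ⌊(1 - δ) * (L : ℝ) ^ 2 / 2⌋₊) 0 → star φ ⬝ᵥ φ = 1 →
        (star φ ⬝ᵥ (hubbardTorus 2 L 1 U *ᵥ φ)).re ≤
          (hubbardTorus 2 L 1 U).minEnergyOn (szSector (2 * ⌊(1 - δ) * (L : ℝ) ^ 2 / 2⌋₊) 0) + κ →
        (expect ((pairField dWaveFormFactor L)ᴴ * pairField dWaveFormFactor L) φ).re / (L : ℝ) ^ 4 ≤
          64 * Real.sqrt 2 * Real.sqrt U + ε :=
  fun _ _ hU hδ0 hδ2 κ _ hε => window_lro_le hU hδ0 hδ2 κ hε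

end Summit.HubbardSuperconductivity.HubbardSuperconductivity.Theorems.LowEnergyRigidity.OrderCeiling
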